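import Summits.QuantumFields.GaugeBoot.CentralLoopEquations
import Summits.QuantumFields.GaugeBoot.ZdSchwingerDysonDLR
import HarnessLib

/-!
# Loop equations along central directions on `ℤ^d`: gauge-invariant test functions suffice; `U(1)` rows ⇔ DLR (gauge-boot, L1 supplement)

HONEST FRAMING (cell `pub-gaugeboot`, page 1 of every file): the venture produces certified bounds
on lattice expectations at stated coupling, gauge group, dimension and torus size; NOT a mass gap,
NOT a continuum limit, NOT a string tension; NOT Yang–Mills-summit-bearing (barriers
`FixedCouplingUltralocality`, `PerturbativeInvisibility`). This module is a structural statement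
about infinite-volume lattice gauge states; it certifies no number.

## Content — the `ℤ^d` companion of `CentralLoopEquations.lean`

* ★ `IsSchwingerDysonStateOn.isSchwingerDysonState_of_invariant` (abstract, countably many links):
  for an `act`-INVARIANT finite measure and a family of one-parameter subgroups exhausting `G`
  whose one-link shifts commute with the action of the compact group `H` (central subgroups when
  `H` is the gauge group), invariant local actions: the Schwinger–Dyson rows for the INVARIANT test
  functions imply the rows for ALL test functions;
* ★★ `isSchwingerDysonStateOn_gaugeInvariant_iff_mem_ymGibbsMeasures` — `ℤ^d`, `G` compact
  metrisable, `ρ` continuous, ANY real `β`, central family exhausting `G` along which the one-link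
  boundary actions are differentiable: a GAUGE-INVARIANT probability measure satisfies the rows
  for gauge-invariant test functions iff it is a DLR state of the Wilson specification;
* ★★ `avgMeasure_mem_ymGibbsMeasures_of_sdOn_gaugeInvariant` — ANY probability measure satisfying
  the gauge-invariant rows: its gauge average is a DLR state (and agrees with it on every
  gauge-invariant observable, `integral_avgMeasure_gaugeTransformZd_of_invariant`);
* ★★★ `isSchwingerDysonStateOn_gaugeInvariant_iff_mem_ymGibbsMeasures_u1`,
  ★★★ `avgMeasure_mem_ymGibbsMeasures_of_sdOn_gaugeInvariant_u1` — UNCONDITIONAL for compact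
  `U(1)` on `ℤ^d`, every `d`, every real `β`: the gauge-invariant loop equations (one-link
  Schwinger–Dyson rows along `e^{tX}`, `X ∈ 𝔲(1)`, gauge-invariant test functions) of a
  gauge-invariant probability measure hold iff it is an infinite-volume Gibbs state; for any
  probability solution the gauge-invariant sector is that of a DLR state. With
  `IsHaarShiftState.eq_of_small` (`HaarShiftUniqueness`) the solution is unique at strong coupling.

References: Z. Li, S. Zhou, arXiv:2404.17071 §2 (the `U(1)` loop equations on the infinite
lattice); E. Seiler, LNP 159 (1982) Ch. 2; H.-O. Georgii (2011) §5.1. Folklore.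
-/

noncomputable section

open MeasureTheory
open Literature.MathematicalPhysics.QuantumLattice
open Literature.MathematicalPhysics.QuantumFieldTheory (haarProbability)
open Literature.Probability.LatticeModels (Site)

namespace Summit.QuantumFields.GaugeBoot

/-! ## Abstract: invariant rows ⇒ all rows, for an invariant state (countably many links) -/

section Abstract

variable {ι : Type*} [DecidableEq ι] [Countable ι] {G : Type*} [Group G] [TopologicalSpace G]
  [IsTopologicalGroup G] [CompactSpace G] [MeasurableSpace G] [BorelSpace G]
  [SecondCountableTopology G] {K : Type*} {k : K → ℝ → G} {S : ι → (ι → G) → ℝ} {β : ℝ}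
  {H : Type*} [TopologicalSpace H] [Group H] [IsTopologicalGroup H] [CompactSpace H]
  [MeasurableSpace H] [BorelSpace H] [SecondCountableTopology H] {act : H → (ι → G) → (ι → G)}

/-- ★ **Invariant state: the rows for invariant test functions imply all rows** (countably many
links). `H` compact acting jointly continuously, `μ` finite and `act`-invariant, a family of
continuous one-parameter subgroups EXHAUSTING `G` whose one-link shifts commute with the action,
continuous invariant local actions differentiable along the family, `P ⊇` invariant observables:
`IsSchwingerDysonStateOn P ⇒ IsSchwingerDysonState`. Proof: invariant rows ⇒ Haar-shift identity for
invariant observables ⇒ for all observables (orbit averaging) ⇒ rows for all test functions.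
[folklore] -/
theorem IsSchwingerDysonStateOn.isSchwingerDysonState_of_invariant (hkc : ∀ a, Continuous (k a))
    (hk : ∀ a s t, k a (s + t) = k a s * k a t) (hG : ∀ g : G, ∃ a t, k a t = g)
    (hS : ∀ i, Continuous (S i))
    (hSd : ∀ (i : ι) (a : K), ∃ S' : (ι → G) → ℝ, Continuous S' ∧
      ∀ U, HasDerivAt (fun t => S i (Function.update U i (k a t * U i))) (S' U) 0)
    {P : ((ι → G) → ℝ) → Prop} (hP : ∀ f : (ι → G) → ℝ, (∀ h U, f (act h U) = f U) → P f)
    (hmul : ∀ h h' U, act (h * h') U = act h (act h' U))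
    (hact : Continuous fun p : H × (ι → G) => act p.1 p.2)
    (hcomm : ∀ (h : H) (i : ι) (a : K) (t : ℝ) (U : ι → G),
      act h (Function.update U i (k a t * U i)) = Function.update (act h U) i (k a t * act h U i))
    (hSinv : ∀ (h : H) (i : ι) (U : ι → G), S i (act h U) = S i U) {μ : Measure (ι → G)}
    [IsFiniteMeasure μ] (hμinv : ∀ h, μ.map (act h) = μ) (hμ : IsSchwingerDysonStateOn P k S β μ) :
    IsSchwingerDysonState k S β μ := by
  refine isSchwingerDysonState_of_haarShift hkc hk hS hSd fun i g F hF => ?_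
  obtain ⟨a, t, rfl⟩ := hG g
  have hcomm' : ∀ (h : H) (U : ι → G), act h (Function.update U i ((k a t)⁻¹ * U i)) =
      Function.update (act h U) i ((k a t)⁻¹ * act h U i) := fun h U => by
    simpa only [update_oneParam_neg (hk a)] using hcomm h i a (-t) U
  exact haarShift_of_forall_invariant hmul hact hμinv i (k a t) (fun h U => hcomm h i a t U) hcomm'
    (hSinv · i) (hS i) (fun F hF hFi => hμ.integral_comp_update_mul_of_invariant hkc hk hS hP i a
      (fun h t U => hcomm h i a t U) (hSinv · i) t F hF hFi) F hF

/-- ★ **Invariant state: invariant rows ⇔ all rows** (data of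
`IsSchwingerDysonStateOn.isSchwingerDysonState_of_invariant`). [folklore] -/
theorem isSchwingerDysonStateOn_iff_of_invariant (hkc : ∀ a, Continuous (k a))
    (hk : ∀ a s t, k a (s + t) = k a s * k a t) (hG : ∀ g : G, ∃ a t, k a t = g)
    (hS : ∀ i, Continuous (S i))
    (hSd : ∀ (i : ι) (a : K), ∃ S' : (ι → G) → ℝ, Continuous S' ∧
      ∀ U, HasDerivAt (fun t => S i (Function.update U i (k a t * U i))) (S' U) 0)
    {P : ((ι → G) → ℝ) → Prop} (hP : ∀ f : (ι → G) → ℝ, (∀ h U, f (act h U) = f U) → P f)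
    (hmul : ∀ h h' U, act (h * h') U = act h (act h' U))
    (hact : Continuous fun p : H × (ι → G) => act p.1 p.2)
    (hcomm : ∀ (h : H) (i : ι) (a : K) (t : ℝ) (U : ι → G),
      act h (Function.update U i (k a t * U i)) = Function.update (act h U) i (k a t * act h U i))
    (hSinv : ∀ (h : H) (i : ι) (U : ι → G), S i (act h U) = S i U) (μ : Measure (ι → G))
    [IsFiniteMeasure μ] (hμinv : ∀ h, μ.map (act h) = μ) :
    IsSchwingerDysonStateOn P k S β μ ↔ IsSchwingerDysonState k S β μ :=
  ⟨fun hμ => hμ.isSchwingerDysonState_of_invariant hkc hk hG hS hSd hP hmul hact hcomm hSinv hμinv,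
    fun hμ => hμ.on P⟩

end Abstract

/-! ## The gauge group action on `ℤ^d` -/

section GaugeGroup

variable {d : ℕ} {G : Type*} [Group G]

/-- **One-link shifts by central elements commute with gauge transformations on `ℤ^d`.**
[folklore] -/
theorem gaugeTransformZd_update_mul_of_central {z : G} (hz : ∀ g : G, g * z = z * g)
    (h : Site d → G) (U : LGConfig d G) (e : ZdEdge d) :
    gaugeTransformZd h (Function.update U e (z * U e)) =
      Function.update (gaugeTransformZd h U) e (z * gaugeTransformZd h U e) := by
  funext e'
  by_cases he : e' = e
  · subst he
    simp only [gaugeTransformZd, Function.update_self]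
    rw [← mul_assoc (h e'.1) z, hz (h e'.1), mul_assoc z, mul_assoc z]
  · simp only [gaugeTransformZd, Function.update_of_ne he]

variable [TopologicalSpace G] [IsTopologicalGroup G]

/-- **The gauge action of `ℤ^d` is a jointly continuous group action** — the inputs `hmul`, `hact`
of `InvariantSchwingerDysonRows.lean` in one package: `U^{g g'} = (U^{g'})^{g}` and `(g, U) ↦ U^g` is
continuous. [folklore] -/
theorem gaugeTransformZd_action :
    (∀ (g g' : Site d → G) (U : LGConfig d G),
        gaugeTransformZd (g * g') U = gaugeTransformZd g (gaugeTransformZd g' U)) ∧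
      Continuous fun p : (Site d → G) × LGConfig d G => gaugeTransformZd p.1 p.2 := by
  refine ⟨fun g g' U => funext fun e => ?_, continuous_pi fun e => ?_⟩
  · simp only [gaugeTransformZd, Pi.mul_apply, mul_inv_rev, mul_assoc]
  · exact ((((continuous_apply e.1).comp continuous_fst).mul
      ((continuous_apply e).comp continuous_snd)).mul
      (((continuous_apply (e.1 + Pi.single e.2 1)).comp continuous_fst).inv))

end GaugeGroup

/-! ## `ℤ^d`: central families, DLR states -/

section Zd

variable {d N : ℕ} {G : Type*} [Group G] [TopologicalSpace G] [IsTopologicalGroup G]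
  [CompactSpace G] [MeasurableSpace G] [BorelSpace G] [SecondCountableTopology G] [T2Space G]
  (ρ : G →* Matrix (Fin N) (Fin N) ℂ) {K : Type*} {k : K → ℝ → G}

/-- ★★ **`ℤ^d`, gauge-invariant state, central family exhausting `G`: rows for gauge-invariant
test functions ⇔ DLR.** `G` compact metrisable, `ρ` continuous, ANY real `β`, `k a` continuous
central one-parameter subgroups with every `g ∈ G` some `k a t`, along which the one-link boundary
actions `S_e = wilsonBoundaryAction ρ {e}` are differentiable with continuous derivative: a
gauge-invariant probability measure on `LGConfig d G` satisfies the Schwinger–Dyson rows for the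
GAUGE-INVARIANT test functions iff it is an infinite-volume Gibbs state of the Wilson
specification. [folklore] -/
theorem isSchwingerDysonStateOn_gaugeInvariant_iff_mem_ymGibbsMeasures
    (hkc : ∀ a, Continuous (k a)) (hk : ∀ a s t, k a (s + t) = k a s * k a t)
    (hG : ∀ g : G, ∃ a t, k a t = g) (hcen : ∀ (a : K) (t : ℝ) (g : G), g * k a t = k a t * g)
    (hρ : Continuous ρ)
    (hSd : ∀ (e : ZdEdge d) (a : K), ∃ S' : LGConfig d G → ℝ, Continuous S' ∧
      ∀ U, HasDerivAt (fun t => wilsonBoundaryAction ρ {e} (Function.update U e (k a t * U e)))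
        (S' U) 0)
    (β : ℝ) (μ : Measure (LGConfig d G)) [IsProbabilityMeasure μ]
    (hμinv : ∀ g : Site d → G, μ.map (gaugeTransformZd g) = μ) :
    IsSchwingerDysonStateOn IsZdGaugeInvariant k (fun e => wilsonBoundaryAction ρ {e}) β μ ↔
      μ ∈ ymGibbsMeasures ρ β := by
  rw [← isSchwingerDysonState_iff_mem_ymGibbsMeasures ρ hkc hk hG hρ hSd β μ]
  exact isSchwingerDysonStateOn_iff_of_invariant hkc hk hG
    (fun e => continuous_wilsonBoundaryAction ρ hρ {e}) hSd (P := IsZdGaugeInvariant)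
    (act := gaugeTransformZd) (fun _ hf => hf) gaugeTransformZd_action.1 gaugeTransformZd_action.2
    (fun h e a t U => gaugeTransformZd_update_mul_of_central (hcen a t) h U e)
    (fun h e U => wilsonBoundaryAction_gaugeTransformZd ρ {e} h U) μ hμinv

/-- ★★ **`ℤ^d`, ANY state, central family exhausting `G`: the gauge average of a probability
solution of the gauge-invariant rows is a DLR state.** [folklore] -/
theorem avgMeasure_mem_ymGibbsMeasures_of_sdOn_gaugeInvariant
    (hkc : ∀ a, Continuous (k a)) (hk : ∀ a s t, k a (s + t) = k a s * k a t)
    (hG : ∀ g : G, ∃ a t, k a t = g) (hcen : ∀ (a : K) (t : ℝ) (g : G), g * k a t = k a t * g)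
    (hρ : Continuous ρ)
    (hSd : ∀ (e : ZdEdge d) (a : K), ∃ S' : LGConfig d G → ℝ, Continuous S' ∧
      ∀ U, HasDerivAt (fun t => wilsonBoundaryAction ρ {e} (Function.update U e (k a t * U e)))
        (S' U) 0)
    {β : ℝ} {μ : Measure (LGConfig d G)} [IsProbabilityMeasure μ]
    (hμ : IsSchwingerDysonStateOn IsZdGaugeInvariant k (fun e => wilsonBoundaryAction ρ {e}) β μ) :
    avgMeasure (gaugeTransformZd (d := d) (G := G)) μ ∈ ymGibbsMeasures ρ β := by
  haveI := isProbabilityMeasure_avgMeasure (act := gaugeTransformZd (d := d) (G := G))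
    gaugeTransformZd_action.2 μ
  exact (isSchwingerDysonStateOn_gaugeInvariant_iff_mem_ymGibbsMeasures ρ hkc hk hG hcen hρ hSd β _
    (map_avgMeasure_act gaugeTransformZd_action.1 gaugeTransformZd_action.2 μ)).1
    (hμ.avgMeasure gaugeTransformZd_action.2
      (fun h e a t U => gaugeTransformZd_update_mul_of_central (hcen a t) h U e)
      (fun h e U => wilsonBoundaryAction_gaugeTransformZd ρ {e} h U))

omit [T2Space G] in
/-- The gauge average of a state on `ℤ^d` agrees with the state on every gauge-invariant
continuous observable. [folklore] -/
theorem integral_avgMeasure_gaugeTransformZd_of_invariant (μ : Measure (LGConfig d G))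
    [IsFiniteMeasure μ] (F : LGConfig d G → ℝ) (hF : Continuous F) (hFi : IsZdGaugeInvariant F) :
    ∫ U, F U ∂avgMeasure (gaugeTransformZd (d := d) (G := G)) μ = ∫ U, F U ∂μ :=
  integral_avgMeasure_of_invariant gaugeTransformZd_action.2 hF hFi μ

/-- DLR states satisfy the rows of every class of test functions along every family of
continuous one-parameter subgroups exhausting `G` along which the boundary actions are
differentiable. [folklore] -/
theorem sdOn_of_mem_ymGibbsMeasures (hkc : ∀ a, Continuous (k a))
    (hk : ∀ a s t, k a (s + t) = k a s * k a t) (hG : ∀ g : G, ∃ a t, k a t = g)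
    (hρ : Continuous ρ)
    (hSd : ∀ (e : ZdEdge d) (a : K), ∃ S' : LGConfig d G → ℝ, Continuous S' ∧
      ∀ U, HasDerivAt (fun t => wilsonBoundaryAction ρ {e} (Function.update U e (k a t * U e)))
        (S' U) 0)
    {β : ℝ} {μ : Measure (LGConfig d G)} [IsProbabilityMeasure μ] (hμ : μ ∈ ymGibbsMeasures ρ β)
    (P : (LGConfig d G → ℝ) → Prop) :
    IsSchwingerDysonStateOn P k (fun e => wilsonBoundaryAction ρ {e}) β μ :=
  ((isSchwingerDysonState_iff_mem_ymGibbsMeasures ρ hkc hk hG hρ hSd β μ).2 hμ).on P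

end Zd

/-! ## Compact `U(1)` on `ℤ^d` -/

section U1

variable {d : ℕ}

/-- The one-link boundary actions of `U(N)` are differentiable along the exponential shifts
`e^{tX}`, `X ∈ 𝔲(N)` (`OneLinkShiftCalculus`). [folklore] -/
theorem exists_hasDerivAt_wilsonBoundaryAction_uExp (N : ℕ) (e : ZdEdge d) (X : UGenerator N) :
    ∃ S' : LGConfig d (Matrix.unitaryGroup (Fin N) ℂ) → ℝ, Continuous S' ∧
      ∀ U, HasDerivAt (fun t => wilsonBoundaryAction (unitaryFundamentalRep (Fin N) ℂ) {e}
        (Function.update U e (uExp N X t * U e))) (S' U) 0 :=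
  exists_hasDerivAt_wilsonBoundaryAction_oneLink (unitaryFundamentalRep (Fin N) ℂ)
    (continuous_unitaryFundamentalRep _ _) (uExp_add N X) (X := (X : Matrix (Fin N) (Fin N) ℂ))
    (fun t => by rw [unitaryFundamentalRep_apply, coe_uExp, Complex.coe_smul]) {e} e

/-- ★★★ **`U(1)` ON `ℤ^d`, GAUGE-INVARIANT STATE: the gauge-invariant loop equations hold iff the
state is DLR.** Compact `U(1)` lattice gauge theory on `ℤ^d`, every `d`, every real `β`: a
gauge-invariant probability measure on `LGConfig d U(1)` satisfies the one-link Schwinger–Dyson rows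
along `U ↦ U[e ↦ e^{tX} U_e]`, `X ∈ 𝔲(1)`, for every GAUGE-INVARIANT test function iff it is an
infinite-volume Gibbs (DLR) state of the Wilson specification. UNCONDITIONAL. [folklore] -/
theorem isSchwingerDysonStateOn_gaugeInvariant_iff_mem_ymGibbsMeasures_u1 (β : ℝ)
    (μ : Measure (LGConfig d (Matrix.unitaryGroup (Fin 1) ℂ))) [IsProbabilityMeasure μ]
    (hμinv : ∀ g : Site d → Matrix.unitaryGroup (Fin 1) ℂ, μ.map (gaugeTransformZd g) = μ) :
    IsSchwingerDysonStateOn IsZdGaugeInvariant (uExp 1)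
        (fun e => wilsonBoundaryAction (unitaryFundamentalRep (Fin 1) ℂ) {e}) β μ ↔
      μ ∈ ymGibbsMeasures (unitaryFundamentalRep (Fin 1) ℂ) β :=
  isSchwingerDysonStateOn_gaugeInvariant_iff_mem_ymGibbsMeasures (unitaryFundamentalRep (Fin 1) ℂ)
    (continuous_uExp 1) (uExp_add 1) (fun g => exists_uExp_eq 1 g)
    (fun _ _ g => unitaryGroup_fin_one_comm g _) (continuous_unitaryFundamentalRep _ _)
    (fun e X => exists_hasDerivAt_wilsonBoundaryAction_uExp 1 e X) β μ hμinv

/-- ★★★ **`U(1)` ON `ℤ^d`, ANY STATE: the gauge average of a probability solution of the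
gauge-invariant loop equations is a DLR state** — so the gauge-invariant sector of any solution is
that of an infinite-volume Gibbs state (`integral_avgMeasure_gaugeTransformZd_of_invariant`), unique
for `|β| < 1/(6(d-1))` (`IsHaarShiftState.eq_of_small`). UNCONDITIONAL. [folklore] -/
theorem avgMeasure_mem_ymGibbsMeasures_of_sdOn_gaugeInvariant_u1 {β : ℝ}
    {μ : Measure (LGConfig d (Matrix.unitaryGroup (Fin 1) ℂ))} [IsProbabilityMeasure μ]
    (hμ : IsSchwingerDysonStateOn IsZdGaugeInvariant (uExp 1)
      (fun e => wilsonBoundaryAction (unitaryFundamentalRep (Fin 1) ℂ) {e}) β μ) :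
    avgMeasure (gaugeTransformZd (d := d) (G := Matrix.unitaryGroup (Fin 1) ℂ)) μ ∈
      ymGibbsMeasures (unitaryFundamentalRep (Fin 1) ℂ) β :=
  avgMeasure_mem_ymGibbsMeasures_of_sdOn_gaugeInvariant (unitaryFundamentalRep (Fin 1) ℂ)
    (continuous_uExp 1) (uExp_add 1) (fun g => exists_uExp_eq 1 g)
    (fun _ _ g => unitaryGroup_fin_one_comm g _) (continuous_unitaryFundamentalRep _ _)
    (fun e X => exists_hasDerivAt_wilsonBoundaryAction_uExp 1 e X) hμ

/-- `U(1)` on `ℤ^d`: DLR states satisfy the gauge-invariant rows (and all others). [folklore] -/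
theorem sdOn_gaugeInvariant_of_mem_ymGibbsMeasures_u1 {β : ℝ}
    {μ : Measure (LGConfig d (Matrix.unitaryGroup (Fin 1) ℂ))} [IsProbabilityMeasure μ]
    (hμ : μ ∈ ymGibbsMeasures (unitaryFundamentalRep (Fin 1) ℂ) β) :
    IsSchwingerDysonStateOn IsZdGaugeInvariant (uExp 1)
      (fun e => wilsonBoundaryAction (unitaryFundamentalRep (Fin 1) ℂ) {e}) β μ :=
  sdOn_of_mem_ymGibbsMeasures (unitaryFundamentalRep (Fin 1) ℂ) (continuous_uExp 1) (uExp_add 1)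
    (fun g => exists_uExp_eq 1 g) (continuous_unitaryFundamentalRep _ _)
    (fun e X => exists_hasDerivAt_wilsonBoundaryAction_uExp 1 e X) hμ IsZdGaugeInvariant

end U1

end Summit.QuantumFields.GaugeBoot

end
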